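import Summits.HodgeConjecture.HodgeConjecture.Theorems.Ring2AbelianAllSpreadFloorCodimension
import Literature.AlgebraicGeometry.HodgeTheory.HodgeClassesProductSpanCMSquare
import Literature.NumberTheory.EllipticCurves.CMEndomorphismOfMulMemLattice
import HarnessLib

/-!
# Ring 2 · AbelianAll · SPREADING axis, part XXVI — CODIMENSION HEREDITY: where `F_CM^mid` (N104) and `F_CM` (N1) can differ.
# Fact-free: `HC_AV⁽ᵐ⁾ → HC_AV⁽ᵖ⁾` and `HC_CM⁽ᵐ⁾ → HC_CM⁽ᵖ⁾` for `p ≤ m` (the product step in EVERY codimension, CM factors of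
# every dimension exist); `F_CM^mid` read pointwise gives a CM failure in codimension `max(p, dim A - p)`, `F_CM` one in
# codimension `p`. Mod Deligne's printed fact: the two nodes agree at every failure at or above the middle, `F_CM` holds
# outright when `HC_CM` fails in codimension `2`, and `F_CM^mid ∧ ¬F_CM` forces `HC_CM⁽²⁾ ∧ ¬HC_CM`

research route, not a corollary; conditional on HC_CM plus one named minimal statement.
(Cell line: research route conditional on HC_CM; not a corollary; Q11.4-sentence-2 already refuted in dim ≥ 3.)

Seat `pub-hodge-ring2-ab-spread-1` (SPREADING), generation 29. Nothing in this file is a case of the Hodge conjecture,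
and NO node / def / abbrev / named fact is minted: as in part XXV the codimension-graded shapes are DISPLAY-ONLY local
notations for unfoldings of the EXISTING constants `HodgeAbelianVarieties` (`HC_AV`, `Theses.PadicSemiregularLift`) and
`CMAbelianHodge` (`HC_CM`, `Theses.RankFourFaces`; always a binder, never a fact):

* `HC_AV⁽p⁾`   : every rational `(p,p)`-class on every complex abelian variety is algebraic (codimension `p` fixed);
* `HC_CM⁽p⁾`   : the same on every abelian variety OF CM TYPE (`Milne1999.IsOfCMType`);
* `HC_AVmid⁽m⁾`: the same in codimension `m` on abelian varieties of dimension `2m`.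

The item `Theses.RankFourFaces.CMToAbelian` (stmt-HodgeConjecture-16267) stays OPEN; `F_CM` = part VII's
`HodgeFailureSpreadsToCMFibre` (census N1), `F_CM^mid` = part XXIV's `MiddleHodgeFailureSpreadsToCMFibre` (census N104, the least
TYPED fact-free exact complement of `HC_CM` of record since census v48; "strictly below `F_CM`" NOT claimed, "minimal" claimed
for nothing). Part XXV located both EXACTLY mod `hF := Deligne1982.deligne1982_cmDenseMumfordTateFamilies`:
`F_CM ⟺ ∀ p, (HC_CM⁽p⁾ → HC_AV⁽p⁾)`, `F_CM^mid ⟺ ∀ m ≥ 2, (HC_CM⁽m⁾ → HC_AVmid⁽m⁾)`, and recorded (honest column (b)) that the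
middle-degree reduction of part XV CHANGES the codimension, so the two gradings do not align. This file types that remark.

## What is proved

* §1 (NO fact) DOWNWARD HEREDITY: the product half of BFNP Lemma 48 inside abelian varieties in EVERY codimension
  (`mem_algebraicClasses_of_prod_codim` = part XV §1 without its middle-degree side condition), hence
  `p ≤ m → HC_AV⁽m⁾ → HC_AV⁽p⁾` (`B := E^{m-p}`) and `p ≤ m → HC_CM⁽m⁾ → HC_CM⁽p⁾` (`B := E₁^{m-p}`, `E₁` the tree's CM curve
  `exists_cmCurve_sqrt_neg 1` / `isOfCMType_of_cmCurve`, `IsOfCMType.prod`); codimensions `0, 1` are classical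
  (`algebraicClasses_zero`, Lefschetz `(1,1)` = tree theorem `lefschetzOneOne_rational_holds`). So the displayed UPWARD heredity
  `CM↑ := ∀ p m, 2 ≤ p → p ≤ m → HC_CM⁽p⁾ → HC_CM⁽m⁾` is EQUIVALENT to `HC_CM⁽2⁾ → HC_CM` and holds under `HC_CM` and under `¬HC_CM⁽2⁾`.
* §2 THE SEPARATION LOCUS. NO fact: `F_CM^mid → CM↑ → ∀ p, (HC_CM⁽p⁾ → HC_AV⁽p⁾)`; `¬HC_CM⁽2⁾ → ∀ p, (HC_CM⁽p⁾ → HC_AV⁽p⁾)`;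
  `F_CM^mid → ¬(∀ p, HC_CM⁽p⁾ → HC_AV⁽p⁾) → HC_CM⁽2⁾ ∧ ¬HC_CM`. Mod `hF` (part XXV §4): `F_CM^mid → CM↑ → F_CM`, `¬HC_CM⁽2⁾ → F_CM`,
  `F_CM^mid → ¬F_CM → HC_CM⁽2⁾ ∧ ¬HC_CM ∧ ¬HC_AV` — a model separating N104 from N1 satisfies the Hodge conjecture for CM abelian
  varieties in codimension `2` and violates it in some codimension `≥ 3`.
* §3 THE POINTWISE READING OF `F_CM^mid`. NO fact: at a Hodge failure `(A, p, c)`, `F_CM^mid` gives `¬HC_CM⁽p⁾` if `dim A ≤ 2p`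
  (hard Lefschetz down to codimension `dim A - p`, then part XV's middle cell `(dim A - p, 2p - dim A)`, middle codimension `p`)
  and `¬HC_CM⁽dim A - p⁾` if `2p ≤ dim A` (middle cell `(p, dim A - 2p)`); part XXV's pointwise `F_CM` gives `¬HC_CM⁽p⁾` in both
  halves. Mod `hF`: `F_CM^mid` yields the full instance of `F_CM` at every failure with `dim A ≤ 2p`, and `F_CM^mid ⟺` its
  pointwise reading. The ENTIRE possible difference between N104 and N1 sits strictly below the middle (`2 ≤ p < dim A - p`) and
  consists in lowering a CM failure from codimension `dim A - p` to `p` — which `CM↑` does; this pen knows no other tool for it.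
* §4 the assembled reading `spreadFloor_heredity_reading_of_deligne1982`.

## Honest column

(a) `F_CM^mid → F_CM` is still NOT claimed `HC_CM`-free and NOT refuted: proved here (mod `hF`) in every world satisfying `CM↑`
(so under `HC_CM`, under `¬HC_CM⁽2⁾`, under `HC_AV`); a separating model lives in `HC_CM⁽2⁾ ∧ ¬HC_CM⁽m⁾`, some `m ≥ 3`; none is
known or claimed. "Strictly below `F_CM`" remains NOT claimed for N104, exactly as the census v48 ruling says.
(b) INFORMATIVENESS CAVEAT, typed: mod `hF`, BOTH floor nodes hold OUTRIGHT in any world where `HC_CM` fails in codimension `2`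
(§2) — they constrain only worlds satisfying `HC_CM⁽2⁾`; true of every statement equivalent to some `∀ p, (HC_CM⁽p⁾ → X p)` with
`X 0`, `X 1` classical, by §1. Recorded, not repaired (a repair would be a different node; the pen mints none).
(c) `CM↑` is a DISPLAYED hypothesis in theorem statements only — no def, node, fact or print locator; implied by `HC_CM`, so NOT
an `HC_CM`-free input; used only to NAME what separates the gradings.
(d) Only `N⁰H⁰ = ⊤`, Lefschetz `(1,1)` (tree theorem, counted once) and `H^{2p}(A(ℂ)) = 0` for `p > dim A` are used as cases.
(e) Standing of the nodes and of `B_min` is unchanged; census placement of these rows (labels on N1/N104) is the LEAD's call.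

References: BrosnanFangNiePearlstein2009 (§6 Lemma 48); VoisinHodgeI2002 (Thm. 6.25, Rem. 6.27, §7.3.2, Thm. 11.30);
KerrPearlstein2011 (§3.1); FultonYoungTableaux1997 (App. B §B.1); Milne1999 (§2 p. 54); SilvermanAEC2009 (III.3.6, VI.4.1);
Deligne1982HodgeCycles (Prop. 6.1 (a)(b), p. 71).
-/

noncomputable section

set_option linter.dupNamespace false

open CategoryTheory AlgebraicGeometry MonoidalCategory CartesianMonoidalCategory
open Literature.AlgebraicGeometry Literature.AlgebraicGeometry.Motives
open Literature.AlgebraicGeometry.HodgeTheory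
open Literature.AlgebraicGeometry.Milne1999 (IsOfCMType)
open Literature.AlgebraicGeometry.Deligne1982 (deligne1982_cmDenseMumfordTateFamilies)
open Literature.AlgebraicTopology.SingularHomology

namespace Summit.HodgeConjecture.HodgeConjecture.Ring2.AbelianAll

open Summit.HodgeConjecture.HodgeConjecture
open Summit.HodgeConjecture.HodgeConjecture.Theorems
open Summit.HodgeConjecture.HodgeConjecture.Theses
open Summit.HodgeConjecture.HodgeConjecture.Theses.RankFourFaces (CMAbelianHodge CMToAbelian)
open Summit.HodgeConjecture.HodgeConjecture.Theses.PadicSemiregularLift (HodgeAbelianVarieties)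
open Summit.HodgeConjecture.HodgeConjecture.Ring2.Deform (cmLocus)

variable {𝒳 S : SchemeOver ℂ}

/-! ## §0 Display-only codimension-graded shapes (local notation, as in part XXV; NO def, NO abbrev) -/

/-- `HC_AV⁽p⁾` — DISPLAY ONLY: the Hodge conjecture for complex abelian varieties in codimension `p`. -/
local notation3 (prettyPrint := false) "HC_AV⁽" p "⁾" =>
  ∀ (A : AbelianVariety ℂ) (c : complexBetti A.X (2 * p)), IsRationalClass c →
    IsOfHodgeType A.dim A.X (2 * p) p p c → c ∈ algebraicClasses A.X p

/-- `HC_CM⁽p⁾` — DISPLAY ONLY: the Hodge conjecture for CM abelian varieties in codimension `p`. -/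
local notation3 (prettyPrint := false) "HC_CM⁽" p "⁾" =>
  ∀ (A : AbelianVariety ℂ), IsOfCMType A → ∀ (c : complexBetti A.X (2 * p)), IsRationalClass c →
    IsOfHodgeType A.dim A.X (2 * p) p p c → c ∈ algebraicClasses A.X p

/-- `HC_AVmid⁽m⁾` — DISPLAY ONLY: the Hodge conjecture in the middle codimension `m` on abelian varieties of dimension `2m`. -/
local notation3 (prettyPrint := false) "HC_AVmid⁽" m "⁾" =>
  ∀ (A : AbelianVariety ℂ), A.dim = 2 * m → ∀ (c : complexBetti A.X (2 * m)), IsRationalClass c →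
    IsOfHodgeType A.dim A.X (2 * m) m m c → c ∈ algebraicClasses A.X m

/-- `CM↑` — DISPLAY ONLY: UPWARD heredity of `HC_CM` in codimension from codimension `2` on ("a failure of `HC_CM` in
codimension `m ≥ p ≥ 2` can be lowered to codimension `p`"). A displayed HYPOTHESIS, never asserted; implied by `HC_CM`. -/
local notation3 (prettyPrint := false) "CM↑" =>
  ∀ (p m : ℕ), 2 ≤ p → p ≤ m → HC_CM⁽p⁾ → HC_CM⁽m⁾

/-! ## §1 Fact-free: the product step in every codimension; downward heredity of `HC_AV⁽·⁾` and `HC_CM⁽·⁾` -/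

/-- **The product step inside abelian varieties, in EVERY codimension** (part XV's `mem_algebraicClasses_of_prod_middleDegree`
WITHOUT the side condition `2p + dim B = dim A`): if every rational `(p+r, p+r)`-class on `A × B`, `dim B = r`, is algebraic, so is
every rational `(p,p)`-class `c ∈ H²ᵖ(A)` — `p > dim A`: `H²ᵖ(A(ℂ)) = 0`; else `s_! c = u • ρ` for the slice `s = (𝟙, 0)`, `ρ` rational
of type `(p+r, p+r)` (`exists_smul_isRationalClass_complexGysin`, `isOfHodgeType_complexGysin`), and `c = pr_{1!} s_! c`
(`gysinMap_comp`, `Motives.sliceAt_fst`, `gysinMap_mem_algebraicClasses_of_isSmoothProjective`).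
[cite: BrosnanFangNiePearlstein2009, §6 Lemma 48 (proof)] [cite: VoisinHodgeI2002, §7.3.2] [cite: FultonYoungTableaux1997, App. B §B.1] -/
theorem mem_algebraicClasses_of_prod_codim (A B : AbelianVariety ℂ) {p r : ℕ} (hB : B.dim = r)
    (halg : ∀ c' : complexBetti (A.prod B).X (2 * (p + r)), IsRationalClass c' →
      IsOfHodgeType (A.prod B).dim (A.prod B).X (2 * (p + r)) (p + r) (p + r) c' →
        c' ∈ algebraicClasses (A.prod B).X (p + r))
    (c : complexBetti A.X (2 * p)) (hc : IsRationalClass c) (hpp : IsOfHodgeType A.dim A.X (2 * p) p p c) :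
    c ∈ algebraicClasses A.X p := by
  have hX : IsSmoothProjective A.dim A.X := AbelianVariety.isSmoothProjective_holds
  rcases Nat.lt_or_ge A.dim p with hlt | hpA
  · haveI : Subsingleton (complexBetti A.X (2 * p)) := ComplexPoints.subsingleton_singularCohomology_of_lt hX ℂ (by omega)
    rw [Subsingleton.elim c 0]
    exact Submodule.zero_mem _
  let μ : OrientationFamily := fun _ _ h ↦ (Motives.ComplexPoints.isOrientableOver ℂ h).some
  have hμ : μ.HasPoincareDuality := OrientationFamily.hasPoincareDuality μ
  have hP : IsSmoothProjective r B.X := hB ▸ AbelianVariety.isSmoothProjective_holds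
  have hXP : IsSmoothProjective (A.dim + r) (A.X ⊗ B.X) := IsSmoothProjective.tensor_holds hX hP
  have hab : 2 * p + 2 * (A.dim + r) = 2 * (p + r) + 2 * A.dim := by omega
  obtain ⟨c', hc'def⟩ : ∃ c' : complexBetti (A.X ⊗ B.X) (2 * (p + r)),
      complexGysin μ hX hXP (Motives.sliceAt A.X (1 : B.Points ℂ)) hab c = c' := ⟨_, rfl⟩
  obtain ⟨u, hu0, hu⟩ := exists_smul_isRationalClass_complexGysin μ hX hXP (Motives.sliceAt A.X (1 : B.Points ℂ)) hab
  obtain ⟨ρ, hρrat, hρ⟩ := hu c hc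
  have hc'typ : IsOfHodgeType (A.dim + r) (A.X ⊗ B.X) (2 * (p + r)) (p + r) (p + r) c' := by
    rw [← hc'def]
    exact isOfHodgeType_complexGysin hodgePQ_independent_of_hodgeModel_holds (fun _ _ ↦ nonempty_hodgeModel_holds)
      (fun E _ _ _ ↦ Literature.NumberTheory.Transcendental.exists_deRhamIsoFamily_holds E) μ hX hXP _ hab
      (by omega) (by omega) hpp
  have hdim : (A.prod B).dim = A.dim + r := by rw [AbelianVariety.dim_prod, hB]
  have hρeq : ρ = u⁻¹ • c' := by
    rw [← hc'def, hρ, smul_smul, inv_mul_cancel₀ hu0, one_smul]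
  have hρalg : ρ ∈ algebraicClasses (A.X ⊗ B.X) (p + r) :=
    halg ρ hρrat (by rw [hdim]; exact hρeq ▸ hc'typ.smul u⁻¹)
  have hc'alg : c' ∈ algebraicClasses (A.X ⊗ B.X) (p + r) := by
    rw [← hc'def, hρ]
    exact Submodule.smul_mem _ u hρalg
  have hcc : gysinMap (μ hXP) (μ hX)
      (Motives.AlgPoints.mapContinuous (L := ℂ) (CartesianMonoidalCategory.fst A.X B.X))
      (show 2 * (p + r) + (2 * A.dim - 2 * p) = 2 * (A.dim + r) by omega)
      (show 2 * p + (2 * A.dim - 2 * p) = 2 * A.dim by omega) c' = c := by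
    rw [← hc'def, complexGysin_eq_gysinMap hX hXP (Motives.sliceAt A.X (1 : B.Points ℂ)) _ (q := 2 * A.dim - 2 * p)
        (by omega) (by omega),
      ← LinearMap.comp_apply, ← gysinMap_comp (hμ hXP), ← Motives.AlgPoints.mapContinuous_comp,
      Motives.sliceAt_fst, Motives.AlgPoints.mapContinuous_id, gysinMap_id (hμ hX), LinearMap.id_apply]
  rw [← hcc]
  exact gysinMap_mem_algebraicClasses_of_isSmoothProjective hXP hX (μ hXP) (μ hX) (hμ hX)
    (CartesianMonoidalCategory.fst A.X B.X) _ _ (by omega) hc'alg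

/-- Reindexing a middle cell (bookkeeping). [folklore] -/
theorem forall_codim_middle_congr {m m' : ℕ} (e : m = m') (h : HC_AVmid⁽m⁾) : HC_AVmid⁽m'⁾ := by subst e; exact h

/-- **DOWNWARD HEREDITY of `HC_AV` in codimension: `p ≤ m → HC_AV⁽m⁾ → HC_AV⁽p⁾`**, NO fact: the product step in codimension
`p + (m - p)` with `B` an abelian variety of dimension `m - p` (`exists_abelianVariety_dim_eq_succ`).
[cite: BrosnanFangNiePearlstein2009, §6 Lemma 48 (proof)] [cite: SilvermanAEC2009, III.3.6] -/
theorem forall_codim_AV_of_le {p m : ℕ} (hpm : p ≤ m) (h : HC_AV⁽m⁾) : HC_AV⁽p⁾ := by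
  intro A c hc hpp
  obtain ⟨r, rfl⟩ : ∃ r, m = p + r := ⟨m - p, by omega⟩
  rcases r with _ | r'
  · exact h A c hc hpp
  · obtain ⟨B, hB⟩ := exists_abelianVariety_dim_eq_succ ℂ r'
    exact mem_algebraicClasses_of_prod_codim A B hB (fun c' hc' hpp' ↦ h (A.prod B) c' hc' hpp') c hc hpp

/-- **CM abelian varieties of every positive dimension exist** (kernel): powers of the tree's CM curve `E₁` (`ψ² = -1`,
`exists_cmCurve_sqrt_neg`, `isOfCMType_of_cmCurve`), `IsOfCMType.prod`. [cite: SilvermanAEC2009, Thm. VI.4.1 (b)] [cite: Milne1999, §2 p. 54] -/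
theorem exists_isOfCMType_dim_eq_succ (r : ℕ) : ∃ B : AbelianVariety ℂ, B.dim = r + 1 ∧ IsOfCMType B := by
  obtain ⟨E, ψ, hE, hψ⟩ := Literature.NumberTheory.EllipticCurves.CMEndomorphism.exists_cmCurve_sqrt_neg 1 one_pos
  have hEcm : IsOfCMType E := isOfCMType_of_cmCurve hE one_pos hψ
  induction r with
  | zero => exact ⟨E, hE, hEcm⟩
  | succ r ih =>
    obtain ⟨B, hB, hBcm⟩ := ih
    exact ⟨B.prod E, by rw [AbelianVariety.dim_prod, hB, hE], hBcm.prod hEcm⟩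

/-- **DOWNWARD HEREDITY of `HC_CM` in codimension: `p ≤ m → HC_CM⁽m⁾ → HC_CM⁽p⁾`**, NO fact: the product step with a CM
factor of dimension `m - p` (`exists_isOfCMType_dim_eq_succ`); `A × B` is CM (`IsOfCMType.prod`).
[cite: BrosnanFangNiePearlstein2009, §6 Lemma 48 (proof)] [cite: Milne1999, §2 p. 54] -/
theorem forall_codim_CM_of_le {p m : ℕ} (hpm : p ≤ m) (h : HC_CM⁽m⁾) : HC_CM⁽p⁾ := by
  intro A hA c hc hpp
  obtain ⟨r, rfl⟩ : ∃ r, m = p + r := ⟨m - p, by omega⟩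
  rcases r with _ | r'
  · exact h A hA c hc hpp
  · obtain ⟨B, hB, hBcm⟩ := exists_isOfCMType_dim_eq_succ r'
    exact mem_algebraicClasses_of_prod_codim A B hB (fun c' hc' hpp' ↦ h (A.prod B) (hA.prod hBcm) c' hc' hpp') c hc hpp

/-- `HC_AV⁽0⁾` (`N⁰H⁰ = ⊤`), NO fact. [folklore] -/
theorem forall_codim_AV_zero : HC_AV⁽0⁾ := fun A c _ _ ↦ by rw [algebraicClasses_zero]; exact Submodule.mem_top

/-- `HC_AV⁽1⁾` is Lefschetz's theorem on `(1,1)`-classes (tree theorem `lefschetzOneOne_rational_holds`), NO fact.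
[cite: VoisinHodgeI2002, Thm. 11.30] -/
theorem forall_codim_AV_one : HC_AV⁽1⁾ := fun A c hc hpp ↦
  lefschetzOneOne_rational_holds (AbelianVariety.isSmoothProjective_holds (A := A)) c hc hpp

/-- `HC_CM⁽0⁾`, NO fact. [folklore] -/
theorem forall_codim_CM_zero : HC_CM⁽0⁾ := fun A _ c hc hpp ↦ forall_codim_AV_zero A c hc hpp

/-- `HC_CM⁽1⁾` (Lefschetz `(1,1)`), NO fact. [cite: VoisinHodgeI2002, Thm. 11.30] -/
theorem forall_codim_CM_one : HC_CM⁽1⁾ := fun A _ c hc hpp ↦ forall_codim_AV_one A c hc hpp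

/-- **`CM↑ ⟺ (HC_CM⁽2⁾ → HC_CM)`**, NO fact: downward heredity makes `{p | HC_CM⁽p⁾}` a down-set containing `0, 1`, so upward
heredity from codimension `2` on says exactly that it is everything as soon as it contains `2`. [folklore] -/
theorem cmCodimUp_iff_codim_two_imp_HC_CM : CM↑ ↔ (HC_CM⁽2⁾ → CMAbelianHodge) := by
  refine ⟨fun hU h2 ↦ HC_CM_iff_forall_codim.2 fun m ↦ ?_, fun hU p m hp hpm hCMp ↦ ?_⟩
  · rcases Nat.lt_or_ge m 2 with hm | hm
    · interval_cases m
      · exact forall_codim_CM_zero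
      · exact forall_codim_CM_one
    · exact hU 2 m le_rfl hm h2
  · exact HC_CM_iff_forall_codim.1 (hU (forall_codim_CM_of_le hp hCMp)) m

/-- `HC_CM → CM↑` (so `CM↑` is NOT an `HC_CM`-free input), NO fact. [folklore] -/
theorem cmCodimUp_of_HC_CM (hCM : CMAbelianHodge) : CM↑ :=
  cmCodimUp_iff_codim_two_imp_HC_CM.2 fun _ ↦ hCM

/-- `¬ HC_CM⁽2⁾ → CM↑` (vacuously), NO fact. [folklore] -/
theorem cmCodimUp_of_not_codim_two (h2 : ¬ HC_CM⁽2⁾) : CM↑ :=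
  cmCodimUp_iff_codim_two_imp_HC_CM.2 fun h ↦ absurd h h2

/-! ## §2 The separation locus of `F_CM^mid` versus `F_CM` -/

/-- **`F_CM^mid → CM↑ → ∀ p, (HC_CM⁽p⁾ → HC_AV⁽p⁾)`**, NO fact: `p ≤ 1` classical; `p ≥ 2`: `HC_CM⁽p⁾ → HC_CM⁽2⁾ → HC_CM` (downward,
`CM↑`), then part XXIV's closing `HC_CM ∧ F_CM^mid → HC_AV`. [cite: BrosnanFangNiePearlstein2009, §6 Lemma 48] -/
theorem forall_codim_cmToAbelian_of_middle_of_cmCodimUp (h : MiddleHodgeFailureSpreadsToCMFibre) (hU : CM↑) (p : ℕ)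
    (hCMp : HC_CM⁽p⁾) : HC_AV⁽p⁾ := by
  rcases Nat.lt_or_ge p 2 with hp | hp
  · interval_cases p
    · exact forall_codim_AV_zero
    · exact forall_codim_AV_one
  · have hCM : CMAbelianHodge := cmCodimUp_iff_codim_two_imp_HC_CM.1 hU (forall_codim_CM_of_le hp hCMp)
    exact HC_AV_iff_forall_codim.1 (HC_AV_of_HC_CM_and_middleHodgeFailureSpreadsToCMFibre hCM h) p

/-- **`¬ HC_CM⁽2⁾ → ∀ p, (HC_CM⁽p⁾ → HC_AV⁽p⁾)`**, NO fact: vacuous above codimension `1` (downward heredity), classical below. [folklore] -/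
theorem forall_codim_cmToAbelian_of_not_codim_two (h2 : ¬ HC_CM⁽2⁾) (p : ℕ) (hCMp : HC_CM⁽p⁾) : HC_AV⁽p⁾ := by
  rcases Nat.lt_or_ge p 2 with hp | hp
  · interval_cases p
    · exact forall_codim_AV_zero
    · exact forall_codim_AV_one
  · exact absurd (forall_codim_CM_of_le hp hCMp) h2

/-- **SEPARATION LOCUS, graded form**, NO fact: if `F_CM^mid` holds and the codimension-graded implication fails, then `HC_CM`
holds in codimension `2` and fails (in some codimension `≥ 3`). [folklore] -/
theorem codim_two_and_not_HC_CM_of_middle_of_not_forall_codim (h : MiddleHodgeFailureSpreadsToCMFibre)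
    (hn : ¬ ∀ p : ℕ, HC_CM⁽p⁾ → HC_AV⁽p⁾) : HC_CM⁽2⁾ ∧ ¬ CMAbelianHodge := by
  have h2 : HC_CM⁽2⁾ := by by_contra h2; exact hn (forall_codim_cmToAbelian_of_not_codim_two h2)
  exact ⟨h2, fun hCM ↦ hn (forall_codim_cmToAbelian_of_middle_of_cmCodimUp h (cmCodimUp_of_HC_CM hCM))⟩

/-- **`F_CM^mid → CM↑ → F_CM`**, MOD `hF` (displayed): §2's graded implication and part XXV §4.
[cite: Deligne1982HodgeCycles, Prop. 6.1 (a)(b) (p. 71)] -/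
theorem hodgeFailureSpreadsToCMFibre_of_middle_of_cmCodimUp_of_deligne1982 (hF : deligne1982_cmDenseMumfordTateFamilies)
    (h : MiddleHodgeFailureSpreadsToCMFibre) (hU : CM↑) : HodgeFailureSpreadsToCMFibre :=
  hodgeFailureSpreadsToCMFibre_of_forall_codim_cmToAbelian_of_deligne1982 hF
    (forall_codim_cmToAbelian_of_middle_of_cmCodimUp h hU)

/-- **Under `CM↑`, N1 and N104 coincide: `F_CM ⟺ F_CM^mid`**, MOD `hF` (displayed); the direction `F_CM → F_CM^mid` is part XXIV's
fact-free edge. [cite: Deligne1982HodgeCycles, Prop. 6.1 (a)(b) (p. 71)] -/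
theorem hodgeFailureSpreadsToCMFibre_iff_middle_of_cmCodimUp_of_deligne1982 (hF : deligne1982_cmDenseMumfordTateFamilies)
    (hU : CM↑) : HodgeFailureSpreadsToCMFibre ↔ MiddleHodgeFailureSpreadsToCMFibre :=
  ⟨middleHodgeFailureSpreadsToCMFibre_of_hodgeFailureSpreadsToCMFibre,
    fun h ↦ hodgeFailureSpreadsToCMFibre_of_middle_of_cmCodimUp_of_deligne1982 hF h hU⟩

/-- **`¬ HC_CM⁽2⁾ → F_CM`**, MOD `hF` (displayed): the floor node holds OUTRIGHT wherever `HC_CM` fails in codimension `2`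
(informativeness caveat, honest column (b)). [cite: Deligne1982HodgeCycles, Prop. 6.1 (a)(b) (p. 71)] -/
theorem hodgeFailureSpreadsToCMFibre_of_not_codim_two_of_deligne1982 (hF : deligne1982_cmDenseMumfordTateFamilies)
    (h2 : ¬ HC_CM⁽2⁾) : HodgeFailureSpreadsToCMFibre :=
  hodgeFailureSpreadsToCMFibre_of_forall_codim_cmToAbelian_of_deligne1982 hF (forall_codim_cmToAbelian_of_not_codim_two h2)

/-- **`¬ HC_CM⁽2⁾ → F_CM^mid`**, MOD `hF` (displayed). [cite: Deligne1982HodgeCycles, Prop. 6.1 (a)(b) (p. 71)] -/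
theorem middleHodgeFailureSpreadsToCMFibre_of_not_codim_two_of_deligne1982 (hF : deligne1982_cmDenseMumfordTateFamilies)
    (h2 : ¬ HC_CM⁽2⁾) : MiddleHodgeFailureSpreadsToCMFibre :=
  middleHodgeFailureSpreadsToCMFibre_of_hodgeFailureSpreadsToCMFibre
    (hodgeFailureSpreadsToCMFibre_of_not_codim_two_of_deligne1982 hF h2)

/-- **SEPARATION LOCUS of N104 versus N1**, MOD `hF` (displayed): a model of `F_CM^mid ∧ ¬ F_CM` satisfies `HC_CM⁽2⁾`, violates
`HC_CM` (in some codimension `≥ 3`) and `HC_AV`. None is known or claimed. [cite: Deligne1982HodgeCycles, Prop. 6.1 (a)(b) (p. 71)] -/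
theorem codim_two_and_not_HC_CM_of_middle_of_not_floor_of_deligne1982 (hF : deligne1982_cmDenseMumfordTateFamilies)
    (h : MiddleHodgeFailureSpreadsToCMFibre) (hn : ¬ HodgeFailureSpreadsToCMFibre) :
    HC_CM⁽2⁾ ∧ ¬ CMAbelianHodge ∧ ¬ HodgeAbelianVarieties := by
  obtain ⟨h2, hCM⟩ := codim_two_and_not_HC_CM_of_middle_of_not_forall_codim h
    fun hg ↦ hn (hodgeFailureSpreadsToCMFibre_of_forall_codim_cmToAbelian_of_deligne1982 hF hg)
  exact ⟨h2, hCM, fun hAV ↦ hn (onPathAV_hodgeFailureSpreadsToCMFibre hAV)⟩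

/-! ## §3 The pointwise reading of `F_CM^mid`: a CM failure in codimension `max(p, dim A - p)` -/

/-- **At a Hodge failure `(A, p, c)` AT OR ABOVE the middle (`dim A ≤ 2p`), `F_CM^mid` gives `¬ HC_CM⁽p⁾`** — the SAME conclusion
as `F_CM` — NO fact: `HC_CM⁽p⁾` and `F_CM^mid` give `HC_AVmid⁽p⁾` (part XXV §2); hard Lefschetz reduces `c` to codimension `dim A - p`
(`HardLefschetzNFold.mem_algebraicClasses_of_lt_holds`), and part XV's middle cell `(dim A - p, 2p - dim A)` has middle codimension
`p`. [cite: KerrPearlstein2011, §3.1] [cite: VoisinHodgeI2002, Thm. 6.25, Rem. 6.27, Thm. 11.30] [cite: BrosnanFangNiePearlstein2009, §6 Lemma 48] -/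
theorem not_codim_cm_of_middle_of_dim_le (h : MiddleHodgeFailureSpreadsToCMFibre) {A : AbelianVariety ℂ} {p : ℕ}
    (h2p : A.dim ≤ 2 * p) {c : complexBetti A.X (2 * p)} (hc : IsRationalClass c)
    (hpp : IsOfHodgeType A.dim A.X (2 * p) p p c) (hnc : c ∉ algebraicClasses A.X p) : ¬ HC_CM⁽p⁾ := by
  intro hCMp
  have hX : IsSmoothProjective A.dim A.X := AbelianVariety.isSmoothProjective_holds
  refine hnc ?_
  rcases Nat.lt_or_ge p 2 with hp | hp
  · interval_cases p
    · exact forall_codim_AV_zero A c hc hpp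
    · exact forall_codim_AV_one A c hc hpp
  rcases Nat.lt_or_ge A.dim p with hAp | hAp
  · haveI : Subsingleton (complexBetti A.X (2 * p)) := ComplexPoints.subsingleton_singularCohomology_of_lt hX ℂ (by omega)
    rw [Subsingleton.elim c 0]
    exact Submodule.zero_mem _
  have hmid : HC_AVmid⁽p⁾ := forall_codim_middle_of_middleHodgeFailureSpreadsToCMFibre h p hp hCMp
  rcases Nat.lt_or_ge A.dim (2 * p) with hlt | hge
  · refine HardLefschetzNFold.mem_algebraicClasses_of_lt_holds hX hlt (fun c' hc' hpp' ↦ ?_) c hc hpp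
    exact mem_algebraicClasses_of_middleCell A (p := A.dim - p) (r := 2 * p - A.dim) (by omega)
      (fun B hB c'' hc'' hpp'' ↦ forall_codim_middle_congr (show p = A.dim - p + (2 * p - A.dim) by omega) hmid B hB c''
        hc'' (by rw [hB]; exact hpp'')) c' hc' hpp'
  · exact hmid A (by omega) c hc hpp

/-- **At a Hodge failure `(A, p, c)` AT OR BELOW the middle (`2p ≤ dim A`), `F_CM^mid` gives `¬ HC_CM⁽dim A - p⁾`** — a CM failure in
the COMPLEMENTARY codimension `dim A - p ≥ p`, not in codimension `p` — NO fact: the middle cell `(p, dim A - 2p)` of part XV has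
middle codimension `dim A - p`. [cite: BrosnanFangNiePearlstein2009, §6 Lemma 48] [cite: VoisinHodgeI2002, Thm. 11.30] -/
theorem not_codim_cm_compl_of_middle_of_le_dim (h : MiddleHodgeFailureSpreadsToCMFibre) {A : AbelianVariety ℂ} {p : ℕ}
    (h2p : 2 * p ≤ A.dim) {c : complexBetti A.X (2 * p)} (hc : IsRationalClass c)
    (hpp : IsOfHodgeType A.dim A.X (2 * p) p p c) (hnc : c ∉ algebraicClasses A.X p) : ¬ HC_CM⁽A.dim - p⁾ := by
  intro hCMq
  refine hnc ?_
  rcases Nat.lt_or_ge (A.dim - p) 2 with hq | hq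
  · have hp : p < 2 := by omega
    interval_cases p
    · exact forall_codim_AV_zero A c hc hpp
    · exact forall_codim_AV_one A c hc hpp
  · have hmid : HC_AVmid⁽A.dim - p⁾ := forall_codim_middle_of_middleHodgeFailureSpreadsToCMFibre h _ hq hCMq
    exact mem_algebraicClasses_of_middleCell A (p := p) (r := A.dim - 2 * p) (by omega)
      (fun B hB c' hc' hpp' ↦ forall_codim_middle_congr (show A.dim - p = p + (A.dim - 2 * p) by omega) hmid B hB c' hc'
        (by rw [hB]; exact hpp')) c hc hpp

/-- **Mod `hF`, `F_CM^mid` yields the FULL instance of `F_CM` at every Hodge failure at or above the middle (`dim A ≤ 2p`)**: the CM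
failure in codimension `p` of `not_codim_cm_of_middle_of_dim_le` and part XXV's product-datum engine
(`exists_isCMAnchoredDatumFor_and_cmFailure_of_deligne1982`). [cite: Deligne1982HodgeCycles, Prop. 6.1 (a)(b) (p. 71)] -/
theorem exists_isCMAnchoredDatumFor_of_middle_of_dim_le_of_deligne1982 (hF : deligne1982_cmDenseMumfordTateFamilies)
    (h : MiddleHodgeFailureSpreadsToCMFibre) {A : AbelianVariety ℂ} (hA : IsSmoothProjective A.dim A.X) {p : ℕ}
    (h2p : A.dim ≤ 2 * p) {c : complexBetti A.X (2 * p)} (hc : IsRationalClass c)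
    (hpp : IsOfHodgeType A.dim A.X (2 * p) p p c) (hnc : c ∉ algebraicClasses A.X p) :
    ∃ (n : ℕ) (𝒳 S : SchemeOver ℂ) (f : 𝒳 ⟶ S) (s : ComplexPoints S) (W : complexBetti 𝒳 (2 * p)),
      IsCMAnchoredDatumFor A p c f n s W ∧
        ∃ s' ∈ cmLocus f n, complexBetti.map (fiberι f s') (2 * p) W ∉ algebraicClasses (fiberOver f s') p := by
  have hp : p ≠ 0 := by rintro rfl; exact hnc (forall_codim_AV_zero A c hc hpp)
  have hCMp := not_codim_cm_of_middle_of_dim_le h h2p hc hpp hnc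
  push Not at hCMp
  obtain ⟨B, hB, b, hbQ, hbH, hnb⟩ := hCMp
  exact exists_isCMAnchoredDatumFor_and_cmFailure_of_deligne1982 hF hA hp hc hpp hB hbQ hbH hnb

/-- **POINTWISE READING of `F_CM^mid`, mod `hF`: `F_CM^mid ⟺` (at every Hodge failure `(A, p, c)`: `¬ HC_CM⁽p⁾` if `dim A ≤ 2p`,
`¬ HC_CM⁽dim A - p⁾` if `2p ≤ dim A`)** — versus part XXV's pointwise `F_CM` (`¬ HC_CM⁽p⁾` in both halves); forward fact-free (§3),
converse by part XXV's engine on a middle failure. [cite: Deligne1982HodgeCycles, Prop. 6.1 (a)(b) (p. 71)] -/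
theorem middleHodgeFailureSpreadsToCMFibre_iff_pointwise_of_deligne1982 (hF : deligne1982_cmDenseMumfordTateFamilies) :
    MiddleHodgeFailureSpreadsToCMFibre ↔
      ∀ (A : AbelianVariety ℂ) (p : ℕ) (c : complexBetti A.X (2 * p)), IsRationalClass c →
        IsOfHodgeType A.dim A.X (2 * p) p p c → c ∉ algebraicClasses A.X p →
          (A.dim ≤ 2 * p → ¬ HC_CM⁽p⁾) ∧ (2 * p ≤ A.dim → ¬ HC_CM⁽A.dim - p⁾) := by
  refine ⟨fun h A p c hc hpp hnc ↦ ⟨fun h2p ↦ not_codim_cm_of_middle_of_dim_le h h2p hc hpp hnc,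
    fun h2p ↦ not_codim_cm_compl_of_middle_of_le_dim h h2p hc hpp hnc⟩, fun h ↦ ?_⟩
  intro A hA m hm hdim c hc hpp hnc
  have hCMm : ¬ HC_CM⁽m⁾ := (h A m c hc hpp hnc).1 (by omega)
  push Not at hCMm
  obtain ⟨B, hB, b, hbQ, hbH, hnb⟩ := hCMm
  exact exists_isCMAnchoredDatumFor_and_cmFailure_of_deligne1982 hF hA (by omega) hc hpp hB hbQ hbH hnb

/-! ## §4 The assembled reading -/

/-- **Codimension heredity and the separation locus (parts VII, XXIV, XXV read together), MOD `hF`** (displayed): downward heredity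
(fact-free); under `CM↑ ⟺ (HC_CM⁽2⁾ → HC_CM)` N1 and N104 coincide; both hold when `HC_CM⁽2⁾` fails; `F_CM^mid ∧ ¬F_CM` forces
`HC_CM⁽2⁾ ∧ ¬HC_CM ∧ ¬HC_AV`. Whether N104 is strictly below N1 is NOT asserted either way.
[cite: Deligne1982HodgeCycles, Prop. 6.1 (a)(b) (p. 71)] [cite: BrosnanFangNiePearlstein2009, §6 Lemma 48] -/
theorem spreadFloor_heredity_reading_of_deligne1982 (hF : deligne1982_cmDenseMumfordTateFamilies) :
    (∀ p m : ℕ, p ≤ m → HC_AV⁽m⁾ → HC_AV⁽p⁾) ∧ (∀ p m : ℕ, p ≤ m → HC_CM⁽m⁾ → HC_CM⁽p⁾) ∧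
      (CM↑ ↔ (HC_CM⁽2⁾ → CMAbelianHodge)) ∧
      (CM↑ → (HodgeFailureSpreadsToCMFibre ↔ MiddleHodgeFailureSpreadsToCMFibre)) ∧
      (¬ HC_CM⁽2⁾ → HodgeFailureSpreadsToCMFibre ∧ MiddleHodgeFailureSpreadsToCMFibre) ∧
      (MiddleHodgeFailureSpreadsToCMFibre → ¬ HodgeFailureSpreadsToCMFibre →
        HC_CM⁽2⁾ ∧ ¬ CMAbelianHodge ∧ ¬ HodgeAbelianVarieties) :=
  ⟨fun _ _ ↦ forall_codim_AV_of_le, fun _ _ ↦ forall_codim_CM_of_le, cmCodimUp_iff_codim_two_imp_HC_CM,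
    hodgeFailureSpreadsToCMFibre_iff_middle_of_cmCodimUp_of_deligne1982 hF,
    fun h2 ↦ ⟨hodgeFailureSpreadsToCMFibre_of_not_codim_two_of_deligne1982 hF h2,
      middleHodgeFailureSpreadsToCMFibre_of_not_codim_two_of_deligne1982 hF h2⟩,
    codim_two_and_not_HC_CM_of_middle_of_not_floor_of_deligne1982 hF⟩

end Summit.HodgeConjecture.HodgeConjecture.Ring2.AbelianAll

end
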